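import Mathlib
import HarnessLib
import Literature.MathematicalPhysics.QuantumFieldTheory.Luscher2010.TrivializingMaps
import Literature.MathematicalPhysics.QuantumFieldTheory.Luscher2010.FlowActionSeries
import Summits.Ventures.LatticeQCDFlow.TrivializingMaps.HaarByPartsZeroModes

/-!
HONEST FRAMING: exact (Metropolis-corrected) sampling algorithms for lattice gauge theory; figures of
merit are autocorrelation/cost numbers at stated couplings and volumes; no continuum-physics claim.

# Uniqueness of link gradients for DRIVEN Lüscher-type recursions (cell pub-lqcd, row 30 lean-1 GEN-3; OURS)

`SeriesUniqueness.lean` proves that Lüscher's recursion `Δ S̃^{(0)} = S + c₀`,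
`Δ S̃^{(k+1)} = -∑_{e,a} ∂^a_e S · ∂^a_e S̃^{(k)} + c_{k+1}` on `SU(n)^E` determines the link gradients of every
order.  The ANCHORED recursion of `LuscherSeriesExistence.lean` (`G^{(k)}_{e₀} = anchTerm B k e₀`) has the
same shape but a different order-`0` SOURCE (the anchored plaquette sum `s_{e₀}`) while still being DRIVEN by
the full action `S_W` in the step; this file records the corresponding uniqueness statement, with source and
driver decoupled (`linkDeriv_eq_of_driven`).  Same proof: a difference with constant Laplacian on the field
manifold has zero gradient (`linkDeriv_eq_zero_of_linkLap_eq_const`).  Used by `AnchoredTheoremA.lean`.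
References: M. Lüscher, Commun. Math. Phys. 293 (2010) 899 [arXiv:0907.5491], §4.3 eqs. (4.13)–(4.15).
-/

namespace Summit.Ventures.LatticeQCDFlow.TrivializingMaps

open Literature.MathematicalPhysics.QuantumFieldTheory
open Literature.MathematicalPhysics.QuantumFieldTheory.Luscher2010
open scoped Matrix Matrix.Norms.Frobenius ContDiff

variable {d L n : ℕ} [NeZero L]

/-- **Driven recursions determine the link gradients.**  Two families of smooth ambient functionals
`F k`, `G k` with `Δ F₀ = src + c₀`, `Δ G₀ = src + c'₀` and
`Δ F_{k+1} = -(∑_{e,a} ∂^a_e S · ∂^a_e F_k) + c_{k+1}` (likewise `G`) on `SU(n)^E` — the same driver `S`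
and the same source `src` — have the same constants and the same link gradients on the field manifold at
every order (induction; a difference with constant Laplacian has zero gradient,
`linkDeriv_eq_zero_of_linkLap_eq_const`). [ours] -/
theorem linkDeriv_eq_of_driven (B : SuBasis n) {S src : AmbConfig d L n → ℝ}
    {F G : ℕ → AmbConfig d L n → ℝ} {c c' : ℕ → ℝ}
    (hF : ∀ k, ContDiff ℝ ∞ (F k)) (hG : ∀ k, ContDiff ℝ ∞ (G k))
    (hF0 : ∀ U : GaugeConfig d L (Matrix.specialUnitaryGroup (Fin n) ℂ),
      linkLap B (F 0) (WilsonFlow.coeConfig U) = src (WilsonFlow.coeConfig U) + c 0)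
    (hG0 : ∀ U : GaugeConfig d L (Matrix.specialUnitaryGroup (Fin n) ℂ),
      linkLap B (G 0) (WilsonFlow.coeConfig U) = src (WilsonFlow.coeConfig U) + c' 0)
    (hFs : ∀ (k : ℕ) (U : GaugeConfig d L (Matrix.specialUnitaryGroup (Fin n) ℂ)),
      linkLap B (F (k + 1)) (WilsonFlow.coeConfig U) =
        -(∑ e : Edge d L, ∑ a : B.ι, linkDeriv e (B.T a) S (WilsonFlow.coeConfig U)
            * linkDeriv e (B.T a) (F k) (WilsonFlow.coeConfig U)) + c (k + 1))
    (hGs : ∀ (k : ℕ) (U : GaugeConfig d L (Matrix.specialUnitaryGroup (Fin n) ℂ)),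
      linkLap B (G (k + 1)) (WilsonFlow.coeConfig U) =
        -(∑ e : Edge d L, ∑ a : B.ι, linkDeriv e (B.T a) S (WilsonFlow.coeConfig U)
            * linkDeriv e (B.T a) (G k) (WilsonFlow.coeConfig U)) + c' (k + 1))
    (k : ℕ) :
    c k = c' k ∧ ∀ (e : Edge d L) (a : B.ι) (U : GaugeConfig d L (Matrix.specialUnitaryGroup (Fin n) ℂ)),
      linkDeriv e (B.T a) (F k) (WilsonFlow.coeConfig U) =
        linkDeriv e (B.T a) (G k) (WilsonFlow.coeConfig U) := by
  have main : ∀ k, (∀ U : GaugeConfig d L (Matrix.specialUnitaryGroup (Fin n) ℂ),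
      linkLap B (fun W => F k W - G k W) (WilsonFlow.coeConfig U) = c k - c' k) →
      (c k = c' k ∧ ∀ (e : Edge d L) (a : B.ι)
        (U : GaugeConfig d L (Matrix.specialUnitaryGroup (Fin n) ℂ)),
        linkDeriv e (B.T a) (F k) (WilsonFlow.coeConfig U) =
          linkDeriv e (B.T a) (G k) (WilsonFlow.coeConfig U)) := by
    intro k hL
    obtain ⟨hκ, hD⟩ := linkDeriv_eq_zero_of_linkLap_eq_const B ((hF k).sub (hG k)) hL
    refine ⟨by linarith, fun e a U => ?_⟩
    have h0 := hD e a U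
    rw [linkDeriv_sub_of_differentiableAt e (B.T a) ((hF k).differentiable (by simp) _)
      ((hG k).differentiable (by simp) _)] at h0
    linarith
  induction k with
  | zero =>
    refine main 0 fun U => ?_
    rw [linkLap_sub_of_contDiff B (hF 0) (hG 0), hF0 U, hG0 U]
    ring
  | succ k ih =>
    refine main (k + 1) fun U => ?_
    rw [linkLap_sub_of_contDiff B (hF (k + 1)) (hG (k + 1)), hFs k U, hGs k U]
    have hs : ∑ e : Edge d L, ∑ a : B.ι, linkDeriv e (B.T a) S (WilsonFlow.coeConfig U) *
        linkDeriv e (B.T a) (F k) (WilsonFlow.coeConfig U) =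
        ∑ e : Edge d L, ∑ a : B.ι, linkDeriv e (B.T a) S (WilsonFlow.coeConfig U) *
          linkDeriv e (B.T a) (G k) (WilsonFlow.coeConfig U) := by
      simp only [ih.2]
    rw [hs]
    ring

end Summit.Ventures.LatticeQCDFlow.TrivializingMaps
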